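import Summits.AtomisticToContinuum.Crystallization.Theorems.ChargedEnergyGapChartDialM

/-!
# `ChargedEnergyGap` · the CHART DIAL, part N: THE GAP AT THE DIAL OF RECORD — the square lemma assembled
(decomp-a2c lens-3 g39 node «ChargeFreeGap»)

§1 FRAME FACTS for bond neighbours of `p` (frame of part E, `nn(p) = 1`): a bond neighbour sits in the annulus
   `[1, 101/100]` (`norm_shellCoord_of_adj`); two bond neighbours bonded to each other are at frame distance
   `≤ (101/100)²` (`dist_shellCoord_le_of_adj`); NON-EXCLUSION of any other point `q ≠ q'` by a bond neighbour `q'`: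
   `‖t'‖ ≤ (101/100)·dist t' t` (`norm_shellCoord_le_of_adj`; `nn(q') ≤ dist q' q`, `dist p q' ≤ (101/100)·nn(q')`).
§2 THE MATCHING READ ON BOND NEIGHBOURS (`exists_bondMatching`): the chart's bijection `T ≃ P.image A` composed
   with `q ↦ shellCoord p q` — a map `m` into the rotated pattern, `θ`-close, injective, onto.
   **BOND STRUCTURE FROM THE FOUR-RINGS** (`adj_of_matched_near`, `θ ≤ 3/20`): at a charge-free `p`, two bond
   neighbours whose matched pattern points are nearest neighbours in the pattern (distance `< √2`) ARE BONDED: the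
   four common bond neighbours of `p` and `q₁` (ring number `4`) are matched injectively to pattern points `≠ y₁`
   within `2θ + (101/100)² < √2` of `y₁`, of which the pattern has at most four (part L `ncard_near_le_four`) — so
   they exhaust them.
§3 **THE GAP AT `θ ≤ 3/20`** (`gappedAt_of_bondChartedAt_of_chargeFree`): a thirteenth point `q` in the annulus
   `(101/100, 6/5]·nn(p)` of a charge-free, `θ`-bond-charted `p` is impossible — by CAP OR SQUARE (part M) on the
   pulled-back direction of `q`, either `cap_case_false` (a matched bond neighbour too close in angle) or
   `square_case_false` (the matched square, its sides bonded by §2) fires.  Hence, at charge-free points and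
   `θ ≤ 3/20`, `ChartedAt θ Q p ↔ BondChartedAt θ Q p` (`chartedAt_iff_bondChartedAt_of_chargeFree`).
§4 THE DICTIONARY AND THE LINE AT THE DIAL OF RECORD: `ChargeFreeCharted θ ↔ ChargeFreeShaped θ` for every
   `θ ≤ 3/20` (`chargeFreeCharted_iff_shaped_of_le`), and
   `FarFieldPricing θ R → CleanApproachHarnack θ R M₀ M₁ → ChargeFreeShaped θ → ChartedChargePricing θ`
   (`chartedChargePricing_of_far_cleanApproachHarnack_shaped_of_le`, `θ ≤ 3/20`; literal `θ = 3/20`, `R = 3`,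
   `M₀ = 4`, `M₁ = 80`): hypothesis 3 of the line of record is the pure TWELVE-POINT SHAPE statement at the pricing
   tolerance itself (margin `≈ 0·05` above the measured jitterbug floor `θ_DICT ≈ 0·1004` of `(1/100)`-charge-free
   shells, versus `≈ 0·025` for part K's `θ ≤ 1/8`).

No `sorry`, no new axiom, no instance / notation / option; no new definition (the matching is an `∃ m` lemma).
-/

noncomputable section

open Literature.MathematicalPhysics.StatisticalMechanics
open Literature.Geometry.DiscreteGeometry
open Summit.AtomisticToContinuum.Crystallization.Theses.PricedLinkCensus
open Summit.AtomisticToContinuum.Crystallization.Theorems.ChargedEnergyGapNegative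
open RealInnerProductSpace
namespace Summit.AtomisticToContinuum.Crystallization.Theorems.ChargedEnergyGapChartDial

/-! ## §1 Frame facts for bond neighbours -/

section frame

variable (Q : PeriodicConfiguration 3)

/-- A bond neighbour `q` of `p` sits in the frame annulus `1 ≤ ‖shellCoord p q‖ ≤ 101/100`. -/
theorem norm_shellCoord_of_adj {p q : Q.points} (h : (bonds Q).Adj p q) :
    1 ≤ ‖shellCoord Q p q‖ ∧ ‖shellCoord Q p q‖ ≤ 101 / 100 := by
  have hc : 0 < nn Q p := Blocks.nearestDist_pt_pos Q p
  have hdn : dist (p : E3) q = nn Q p * ‖shellCoord Q p q‖ := dist_eq_nn_mul_norm_shellCoord Q p q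
  obtain ⟨hne, -⟩ := bondGraph_adj.1 h
  have hlo : nn Q p ≤ dist (p : E3) q :=
    nearestDist_le_dist (Subtype.val : Q.points → E3) (fun h' => hne h'.symm)
  have hhi : dist (p : E3) q ≤ (1 + 1 / 100) * nn Q p := dist_le_of_adj (by norm_num) h
  rw [hdn] at hlo hhi
  exact ⟨le_of_mul_le_mul_left (by rw [mul_one]; exact hlo) hc, le_of_mul_le_mul_left (by linarith) hc⟩

/-- Two bond neighbours `q₁`, `q₂` of `p` that are bonded to each other are at frame distance `≤ (101/100)²`
(`dist q₁ q₂ ≤ (101/100)·nn(q₁) ≤ (101/100)·dist p q₁ ≤ (101/100)²·nn(p)`). -/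
theorem dist_shellCoord_le_of_adj {p q₁ q₂ : Q.points} (h₁ : (bonds Q).Adj p q₁) (h₁₂ : (bonds Q).Adj q₁ q₂) :
    dist (shellCoord Q p q₁) (shellCoord Q p q₂) ≤ (101 / 100) ^ 2 := by
  have hc : 0 < nn Q p := Blocks.nearestDist_pt_pos Q p
  have e := dist_eq_nn_mul_dist_shellCoord Q p (q₁ : E3) (q₂ : E3)
  have h1 : dist (q₁ : E3) q₂ ≤ (1 + 1 / 100) * nn Q q₁ := dist_le_of_adj (by norm_num) h₁₂
  have h2 : nn Q q₁ ≤ dist (q₁ : E3) p := nearestDist_le_dist (Subtype.val : Q.points → E3) (bondGraph_adj.1 h₁).1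
  have h3 : dist (p : E3) q₁ ≤ (1 + 1 / 100) * nn Q p := dist_le_of_adj (by norm_num) h₁
  rw [dist_comm] at h2
  rw [e] at h1
  exact le_of_mul_le_mul_left (by linarith) hc

/-- NON-EXCLUSION: a bond neighbour `q'` of `p` keeps every other point `q ≠ q'` outside its own nearest-neighbour
ball, which in the frame of `p` reads `‖t'‖ ≤ (101/100)·dist t' t` (`nn(q') ≤ dist q' q` and
`dist p q' ≤ (101/100)·nn(q')`). -/
theorem norm_shellCoord_le_of_adj {p q q' : Q.points} (h' : (bonds Q).Adj p q') (hne : q ≠ q') :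
    ‖shellCoord Q p q'‖ ≤ 101 / 100 * dist (shellCoord Q p q') (shellCoord Q p q) := by
  have hc : 0 < nn Q p := Blocks.nearestDist_pt_pos Q p
  have hdn : dist (p : E3) q' = nn Q p * ‖shellCoord Q p q'‖ := dist_eq_nn_mul_norm_shellCoord Q p q'
  have e := dist_eq_nn_mul_dist_shellCoord Q p (q' : E3) (q : E3)
  have h1 : nn Q q' ≤ dist (q' : E3) q := nearestDist_le_dist (Subtype.val : Q.points → E3) hne
  have h2 : dist (q' : E3) p ≤ (1 + 1 / 100) * nn Q q' := dist_le_of_adj (by norm_num) h'.symm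
  rw [dist_comm, hdn] at h2
  rw [e] at h1
  exact le_of_mul_le_mul_left (by nlinarith [mul_le_mul_of_nonneg_left h1 (by norm_num : (0 : ℝ) ≤ 1 + 1 / 100)]) hc

end frame

/-! ## §2 The chart's matching read on the bond neighbours -/

section matching

variable {Q : PeriodicConfiguration 3} {p : Q.points} {T R : Finset E3}

/-- **The matching on bond neighbours**: the chart's bijection `e : T ≃ R` (shell points ↔ rotated pattern),
composed with `q ↦ shellCoord p q` (the frame positions of the bond neighbours of `p` are exactly the points of
`T = bondShellSet Q p`), is a map `m` from the bond neighbours of `p` INTO `R`, `θ`-CLOSE to the frame positions,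
INJECTIVE and ONTO `R`. -/
theorem exists_bondMatching (hT : (↑T : Set E3) = bondShellSet Q p) {θ : ℝ} {e : ↥T ≃ ↥R}
    (he : ∀ t : ↥T, dist (t : E3) (e t : E3) ≤ θ) :
    ∃ m : ↥((bonds Q).neighborSet p) → E3, (∀ q, m q ∈ R) ∧
      (∀ q : ↥((bonds Q).neighborSet p), dist (shellCoord Q p q) (m q) ≤ θ) ∧
      Function.Injective m ∧ ∀ y : ↥R, ∃ q, m q = y := by
  have hmem : ∀ q : ↥((bonds Q).neighborSet p), shellCoord Q p q ∈ T := fun q => by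
    rw [← Finset.mem_coe, hT]; exact ⟨q, q.2, rfl⟩
  refine ⟨fun q => (e ⟨shellCoord Q p q, hmem q⟩ : E3), fun q => (e _).2,
    fun q => he ⟨shellCoord Q p q, hmem q⟩, ?_, ?_⟩
  · intro q q' h
    beta_reduce at h
    have h1 := e.injective (Subtype.ext h)
    have h2 := congrArg Subtype.val h1
    exact Subtype.ext (Subtype.ext (shellCoord_injective Q p h2))
  · intro y
    obtain ⟨q', hq', ht⟩ : ((e.symm y : ↥T) : E3) ∈ bondShellSet Q p := by rw [← hT]; exact (e.symm y).2
    refine ⟨⟨q', hq'⟩, ?_⟩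
    have key : e ⟨shellCoord Q p q', hmem ⟨q', hq'⟩⟩ = y := by
      rw [Equiv.apply_eq_iff_eq_symm_apply]; exact Subtype.ext ht
    exact congrArg Subtype.val key

/-- **BOND STRUCTURE from the four-rings** (`θ ≤ 3/20`): at a charge-free `p`, given a matching `m` of its bond
neighbours into a rotated kissing pattern (into, `θ`-close, injective), two distinct bond neighbours whose matched
pattern points are at distance `< √2` (nearest neighbours in the pattern) are bonded to each other.
[The four common bond neighbours of `p` and `q₁` are matched, injectively, to pattern points `≠ m q₁` within
`θ + (101/100)² + θ < √2` of `m q₁`; the pattern has at most four such points (part L, `ncard_near_le_four`); so they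
exhaust them, and `m q₂` being one of them forces `q₂ ∼ q₁`.] -/
theorem adj_of_matched_near {θ : ℝ} (hθ : θ ≤ 3 / 20)
    (hcf : IsChargeFree (1 / 100) (Subtype.val : Q.points → E3) p)
    {P : Finset E3} (hP : P = fccKissingPattern ∨ P = hcpKissingPattern) (A : E3 →ₗᵢ[ℝ] E3)
    {m : ↥((bonds Q).neighborSet p) → E3} (hm₁ : ∀ q, m q ∈ P.image A)
    (hm₂ : ∀ q : ↥((bonds Q).neighborSet p), dist (shellCoord Q p q) (m q) ≤ θ) (hm₃ : Function.Injective m)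
    {q₁ q₂ : ↥((bonds Q).neighborSet p)} (hne : q₁ ≠ q₂) (hd : dist (m q₁) (m q₂) < Real.sqrt 2) :
    (bonds Q).Adj q₁ q₂ := by
  have hs : (13201 / 10000 : ℝ) < Real.sqrt 2 := by rw [Real.lt_sqrt (by norm_num)]; norm_num
  -- the four common bond neighbours of `p` and `q₁`, as bond neighbours of `p`
  set U : Set ↥((bonds Q).neighborSet p) := {q | (q : Q.points) ∈ (bonds Q).neighborSet q₁} with hU
  have hU4 : U.ncard = 4 := by
    have h : ringNumber (1 / 100) (Subtype.val : Q.points → E3) p q₁ = 4 := hcf.2 q₁ q₁.2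
    rw [hU, Set.ncard_subtype, Set.setOf_mem_eq, Set.inter_comm]
    exact h
  -- the pattern points near `m q₁`
  set W : Set E3 := {y | y ∈ P.image A ∧ y ≠ m q₁ ∧ dist (m q₁) y < Real.sqrt 2} with hW
  have hW4 : W.ncard ≤ 4 := ncard_near_le_four hP A (hm₁ q₁)
  have hWfin : W.Finite := (P.image A).finite_toSet.subset fun y hy => hy.1
  have hsub : m '' U ⊆ W := by
    rintro _ ⟨q, hq, rfl⟩
    have hq : (bonds Q).Adj q₁ q := hq
    refine ⟨hm₁ q, fun h => (bondGraph_adj.1 hq).1 (congrArg Subtype.val (hm₃ h)).symm, ?_⟩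
    calc dist (m q₁) (m q)
        ≤ dist (m q₁) (shellCoord Q p q₁) + dist (shellCoord Q p q₁) (shellCoord Q p q) +
          dist (shellCoord Q p q) (m q) := dist_triangle4 _ _ _ _
      _ ≤ θ + (101 / 100) ^ 2 + θ := by
          gcongr
          · rw [dist_comm]; exact hm₂ q₁
          · exact dist_shellCoord_le_of_adj Q q₁.2 hq
          · exact hm₂ q
      _ < Real.sqrt 2 := by linarith
  have hcardU : (m '' U).ncard = 4 := by rw [Set.ncard_image_of_injective _ hm₃, hU4]
  have heq : m '' U = W := Set.eq_of_subset_of_ncard_le hsub (by rw [hcardU]; exact hW4) hWfin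
  have hy₂ : m q₂ ∈ W := ⟨hm₁ q₂, fun h => hne (hm₃ h).symm, hd⟩
  rw [← heq] at hy₂
  obtain ⟨q, hq, hqe⟩ := hy₂
  rw [← hm₃ hqe]
  exact hq

end matching

/-! ## §3 The gap lemma at the dial of record `θ = 3/20` -/

section gap

variable (Q : PeriodicConfiguration 3)

/-- **THE SQUARE LEMMA / GAP AT `θ ≤ 3/20`**: at a `(1/100)`-charge-free point `p` whose bond dozen is `θ`-close to a
kissing pattern, `θ ≤ 3/20`, the annulus `(101/100, 6/5]·nn(p)` contains no point of `Q`.  A thirteenth point `q`,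
read in the frame of `p` as `d` (`1 ≤ ‖d‖ ≤ 6/5`), obeys NON-EXCLUSION against every bond neighbour; by CAP OR SQUARE
(part M) either a pattern direction is within `≈ 37·8°` of `d` — contradicting non-exclusion (`cap_case_false`) — or
`d` is within `≈ 12·8°` of the normal of a square face, whose four matched bond neighbours are pairwise BONDED along
the sides (bond structure from the four-rings) — contradicting `square_case_false`. -/
theorem gappedAt_of_bondChartedAt_of_chargeFree {θ : ℝ} (hθ : θ ≤ 3 / 20) {p : Q.points}
    (hcf : IsChargeFree (1 / 100) (Subtype.val : Q.points → E3) p) (hB : BondChartedAt θ Q p) : GappedAt Q p := by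
  obtain ⟨T, hT, hclose⟩ := hB
  obtain ⟨P, hP, A, e, he⟩ : ∃ P : Finset E3, (P = fccKissingPattern ∨ P = hcpKissingPattern) ∧
      ∃ (A : E3 →ₗᵢ[ℝ] E3) (e : ↥T ≃ ↥(P.image A)), ∀ t : ↥T, dist (t : E3) (e t : E3) ≤ θ := by
    rcases hclose with ⟨A, e, he⟩ | ⟨A, e, he⟩
    · exact ⟨_, Or.inl rfl, A, e, he⟩
    · exact ⟨_, Or.inr rfl, A, e, he⟩
  have hP1 : ∀ v ∈ P, ‖v‖ = 1 := by
    rcases hP with rfl | rfl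
    · exact fun v hv => norm_eq_one_of_mem_fccKissingPattern hv
    · exact fun v hv => norm_eq_one_of_mem_hcpKissingPattern hv
  intro q hqp hqd
  have hc : 0 < nn Q p := Blocks.nearestDist_pt_pos Q p
  set d : E3 := shellCoord Q p q with hd
  have hdn : dist (p : E3) q = nn Q p * ‖d‖ := dist_eq_nn_mul_norm_shellCoord Q p q
  have hd1 : 1 ≤ ‖d‖ := by
    have h := nearestDist_le_dist (Subtype.val : Q.points → E3) hqp
    rw [hdn] at h
    exact le_of_mul_le_mul_left (by rw [mul_one]; exact h) hc
  have hd2 : ‖d‖ ≤ 6 / 5 := by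
    rw [hdn] at hqd
    exact le_of_mul_le_mul_left (by linarith) hc
  by_contra hnot
  -- `q` is not a bond neighbour: non-exclusion against every bond neighbour
  have hex : ∀ q' : ↥((bonds Q).neighborSet p), ‖shellCoord Q p q'‖ ≤ 101 / 100 * dist (shellCoord Q p q') d := by
    intro q'
    have hne : q ≠ (q' : Q.points) := fun h => hnot (by rw [h]; exact q'.2)
    exact norm_shellCoord_le_of_adj Q q'.2 hne
  -- transport `d` back by the chart isometry; CAP OR SQUARE in the pattern
  let Ae : E3 ≃ₗᵢ[ℝ] E3 := A.toLinearIsometryEquiv rfl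
  have hAe : ∀ v, Ae v = A v := fun v => rfl
  have hinn : ∀ w : E3, ⟪Ae.symm d, w⟫ = ⟪d, A w⟫ := fun w => by
    rw [← hAe, ← Ae.inner_map_map (Ae.symm d) w, LinearIsometryEquiv.apply_symm_apply]
  have hnAe : ‖Ae.symm d‖ = ‖d‖ := LinearIsometryEquiv.norm_map _ _
  obtain ⟨m, hm₁, hm₂, hm₃, hm₄⟩ := exists_bondMatching hT he
  have hm : ∀ {w : E3} (hw : w ∈ P), ∃ q' : ↥((bonds Q).neighborSet p), m q' = A w :=
    fun {w} hw => hm₄ ⟨A w, Finset.mem_image_of_mem _ hw⟩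
  rcases exists_cap_or_square hP (Ae.symm d) with ⟨w, hw, hdw⟩ | ⟨w₁, w₂, w₃, w₄, s, hsq, hds⟩
  · -- CAP CASE
    rw [hnAe, hinn] at hdw
    obtain ⟨q', hq'⟩ := hm hw
    have htw : dist (shellCoord Q p q') (A w) ≤ θ := by rw [← hq']; exact hm₂ q'
    exact cap_case_false hθ hd1 hd2 hdw htw (norm_shellCoord_of_adj Q q'.2).2 (hex q')
  · -- SQUARE CASE
    obtain ⟨hw₁, hw₂, hw₃, hw₄, h13, h24, d12, d23, d34, d41, hs2⟩ := hsq
    rw [hnAe, hinn] at hds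
    obtain ⟨q₁, hq₁⟩ := hm hw₁
    obtain ⟨q₂, hq₂⟩ := hm hw₂
    obtain ⟨q₃, hq₃⟩ := hm hw₃
    obtain ⟨q₄, hq₄⟩ := hm hw₄
    have hAd : ∀ {w w' : E3}, dist w w' = 1 → dist (A w) (A w') < Real.sqrt 2 := by
      intro w w' h
      rw [A.isometry.dist_eq, h, Real.lt_sqrt (by norm_num)]
      norm_num
    have hne : ∀ {qa qb : ↥((bonds Q).neighborSet p)} {w w' : E3}, m qa = A w → m qb = A w' →
        dist w w' = 1 → qa ≠ qb := by
      intro qa qb w w' ha hb h hab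
      have h' := A.isometry.dist_eq w w'
      rw [← ha, ← hb, hab, dist_self] at h'
      linarith
    have a₁₂ : (bonds Q).Adj q₁ q₂ :=
      adj_of_matched_near hθ hcf hP A hm₁ hm₂ hm₃ (hne hq₁ hq₂ d12) (by rw [hq₁, hq₂]; exact hAd d12)
    have a₂₃ : (bonds Q).Adj q₂ q₃ :=
      adj_of_matched_near hθ hcf hP A hm₁ hm₂ hm₃ (hne hq₂ hq₃ d23) (by rw [hq₂, hq₃]; exact hAd d23)
    have a₃₄ : (bonds Q).Adj q₃ q₄ :=
      adj_of_matched_near hθ hcf hP A hm₁ hm₂ hm₃ (hne hq₃ hq₄ d34) (by rw [hq₃, hq₄]; exact hAd d34)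
    have a₄₁ : (bonds Q).Adj q₄ q₁ :=
      adj_of_matched_near hθ hcf hP A hm₁ hm₂ hm₃ (hne hq₄ hq₁ d41) (by rw [hq₄, hq₁]; exact hAd d41)
    have hε : ∀ {q' : ↥((bonds Q).neighborSet p)} {w : E3}, m q' = A w →
        dist (shellCoord Q p q') (A w) ≤ θ := by
      intro q' w h; rw [← h]; exact hm₂ q'
    have hy : ∀ {w : E3}, w ∈ P → ‖A w‖ = 1 := fun {w} hw => by rw [A.norm_map, hP1 w hw]
    exact square_case_false hθ hd1 hd2 (S := A s) (by rw [A.norm_map, hs2]) hds (hy hw₁) (hy hw₂) (hy hw₃) (hy hw₄)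
      (by rw [← map_add, h13]) (by rw [← map_add, h24]) (hε hq₁) (hε hq₂) (hε hq₃) (hε hq₄)
      (norm_shellCoord_of_adj Q q₁.2).1 (norm_shellCoord_of_adj Q q₂.2).1 (norm_shellCoord_of_adj Q q₃.2).1
      (norm_shellCoord_of_adj Q q₄.2).1
      (inner_le_of_nonExclusion (norm_shellCoord_of_adj Q q₁.2).2 (hex q₁))
      (inner_le_of_nonExclusion (norm_shellCoord_of_adj Q q₂.2).2 (hex q₂))
      (inner_le_of_nonExclusion (norm_shellCoord_of_adj Q q₃.2).2 (hex q₃))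
      (inner_le_of_nonExclusion (norm_shellCoord_of_adj Q q₄.2).2 (hex q₄))
      (dist_shellCoord_le_of_adj Q q₁.2 a₁₂) (dist_shellCoord_le_of_adj Q q₂.2 a₂₃)
      (dist_shellCoord_le_of_adj Q q₃.2 a₃₄) (dist_shellCoord_le_of_adj Q q₄.2 a₄₁)

/-- At a charge-free point and `θ ≤ 3/20`, the chart IS the shape of the bond dozen:
`ChartedAt θ Q p ↔ BondChartedAt θ Q p`. -/
theorem chartedAt_iff_bondChartedAt_of_chargeFree {θ : ℝ} (hθ : θ ≤ 3 / 20) {p : Q.points}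
    (hcf : IsChargeFree (1 / 100) (Subtype.val : Q.points → E3) p) : ChartedAt θ Q p ↔ BondChartedAt θ Q p :=
  ⟨bondChartedAt_of_chartedAt Q hcf,
    fun hB => chartedAt_of_bondChartedAt Q hB (gappedAt_of_bondChartedAt_of_chargeFree Q hθ hcf hB)⟩

end gap

/-! ## §4 The dictionary and the line at the dial of record -/

/-- SHAPE at `θ ≤ 3/20` forces the GAP conjunct of the dictionary. -/
theorem chargeFreeGapped_of_shaped_of_le {θ : ℝ} (hθ : θ ≤ 3 / 20) (hS : ChargeFreeShaped θ) : ChargeFreeGapped :=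
  fun Q p hp => gappedAt_of_bondChartedAt_of_chargeFree Q hθ hp (hS Q p hp)

/-- **THE DICTIONARY IS THE SHAPE STATEMENT up to the dial of record `θ = 3/20`**:
`ChargeFreeCharted θ ↔ ChargeFreeShaped θ` for `θ ≤ 3/20`. -/
theorem chargeFreeCharted_iff_shaped_of_le {θ : ℝ} (hθ : θ ≤ 3 / 20) : ChargeFreeCharted θ ↔ ChargeFreeShaped θ := by
  rw [chargeFreeCharted_iff_shaped_and_gapped]
  exact ⟨fun h => h.1, fun h => ⟨h, chargeFreeGapped_of_shaped_of_le hθ h⟩⟩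

/-- SHAPE at a tolerance `θ ≤ 3/20` gives the dictionary at every `θ' ≥ θ` (supersedes part K's `θ ≤ 1/8`). -/
theorem chargeFreeCharted_of_shaped_of_le {θ θ' : ℝ} (hθ : θ ≤ 3 / 20) (hθ' : θ ≤ θ') (hS : ChargeFreeShaped θ) :
    ChargeFreeCharted θ' :=
  chargeFreeCharted_mono hθ' ((chargeFreeCharted_iff_shaped_of_le hθ).2 hS)

/-- **The line beneath P after part N**: `FAR θ R ∧ NOZOOM-APPROACH θ R M₀ M₁ ∧ SHAPE θ ⟹ ChartedChargePricing θ`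
for every `θ ≤ 3/20` — hypothesis 3 of the line of record is the pure twelve-point statement `ChargeFreeShaped θ`
at the SAME tolerance as the pricing hypotheses (literal: `θ = 3/20`, `R = 3`, `M₀ = 4`, `M₁ = 80`). -/
theorem chartedChargePricing_of_far_cleanApproachHarnack_shaped_of_le {θ R M₀ M₁ : ℝ} (hθ : θ ≤ 3 / 20)
    (hR : 0 < R) (hM₀ : 0 ≤ M₀) (hF : FarFieldPricing θ R) (hH : CleanApproachHarnack θ R M₀ M₁)
    (hS : ChargeFreeShaped θ) : ChartedChargePricing θ :=
  chartedChargePricing_of_far_cleanApproachHarnack hθ hR hM₀ hF hH ((chargeFreeCharted_iff_shaped_of_le hθ).2 hS)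

end Summit.AtomisticToContinuum.Crystallization.Theorems.ChargedEnergyGapChartDial

end
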